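import Summits.QuantumFields.BalabanUV.T4Continuum.Support.NE3CovariantLineAdjoint
import HarnessLib

/-!
# T⁴ programme, node NE3 — route H♮ row K4, file K4-a (2∕2): THE COVARIANT INSTANCE OF RECORD — copies read AT THE CORNER in the
# tree's left-trivialised convention (`AveragingDeficitTransport.dhol`, C1's `segMain`): `TWc L k W η z κ = Σ_v Σ_{i<M}
# Ad (W(M•z; comb(v) ++ seg_κ(i+1))) (η (M•z+v+i•e_κ) κ)`, its transport family `combFrame = (combTransport … (i+1))⁻¹`, and its
# adjoint identity BY NAME

NE3 formalisation swarm `b2b-balaban-t4-ne3-formalise-*`, LEAF PROVER 03 (unit `b2b-balaban-t4-ne3-formalise-leaf-03`, gen 7; cell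
`pub-balaban`); row **K4** (ruling ρ-g22-2 ∕ ρ-g22-3 (1): abstract transport family ADOPTED), CLAIM journal l.17979; companion of
file 1 `NE3CovariantLineAdjoint` (p228505).

WHY (a located convention point in file 1's §4, recorded honestly).  In the tree a direction `η (x, κ)` is RIGHT-trivialised
(`vary W η s (x,κ) = W(x,κ)·exp(s·η(x,κ))`, gauge modes `BlockAveragePushDirGauge.gaugeDir U m (x,κ) = Ad_{U(x,κ)⁻¹} m x − m (x+e_κ)`), so
its value lives at the END `x + e_κ` of its bond, and the left-trivialised word derivative `AveragingDeficitTransport.dhol` carries the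
copy at the bond `(x,κ)` of a word from `q` to the start frame through `Ad (W(q → x) · W(x,κ)) = Ad (W(q → x + e_κ))` — the holonomy
up to and INCLUDING the copy's own bond, with NO inverse (`dstep_true`, `dhol_cons`; C1's `segMain` = `Σ_r L^{−d}•Ad (hol W q (treeWord r))
(dhol W Y (q+r) (seg κ L))`).  File 1's abstract layer is convention-free (`TWg M g` reads the copies through `Ad (g …)⁻¹`, `WadWg` transports
the coarse values through `Ad (g …)`, and the adjoint identity holds for EVERY unitary family `g`), but its named instance
`TW := TWg (L^k) (combTransport W (L^k))` reads the copy at step `i` through `Ad (W(q → x_i))⁻¹`, which is NOT the corner reading of the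
tree's objects.  THIS FILE supplies the instance of record: the family **`combFrame W M z κ v i := (combTransport W M z κ v (i+1))⁻¹`**
(the inverse holonomy from the corner to the END of the copy's bond along the `κ`-last comb), for which `Ad (combFrame …)⁻¹ =
Ad (combTransport … (i+1))` IS the transport of the copy TO the corner and `Ad (combFrame …)` the transport of a corner value TO the
copy's frame; **`TWc L k W := TWg (L^k) (combFrame W (L^k))`** is the single-scale comb line sum K4-0∕K4-b∕K4-c should consume
(`TW` of file 1 stays as a harmless non-covariant variant; nothing imports it).

CONTENT (all [folklore]; 0 sorry; 0 `def … : Prop`; DATA defs `combFrame`, `TWc`): `combFrame_mem` (unitary), `combFrame_add_period`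
(`N`-periodic in the corner for `(M·N)`-periodic `W`), `Ad_combFrame_inv` (`Ad (combFrame …)⁻¹ X = Ad (combTransport … (i+1)) X`),
**`combFrame_succ`** (`combFrame W M z κ v (i+1) = (W (M•z+v+(i+1)•e_κ) κ)⁻¹ * combFrame W M z κ v i` — one more bond: the covariant
`κ`-step of K4-b's line accumulation), `TWc_eq` (the explicit corner-read sum), **`sum_hsR_TWc_eq`** (the torus adjoint identity for
`TWc` at any unitary `(L^k·N)`-periodic `W`, BY NAME from file 1), `TWc_flatCfg` (at `W = 1` the flat line sum).

HONEST FRAMING.  Exact bookkeeping at a general unitary background on OUR typed objects; no estimate; nothing about Bałaban's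
minimisers; (P♮)_W, (ML_w) at W ≠ 1, T-E_w and NE3 are NOT proved; spine PROVED 0∕9; finite T⁴ rung (B)+1 — NOT infinite volume, NOT
mass gap, NOT BetaPertH, NOT Clay.  ABSOLUTE RULE kept (context only: [Balaban1985Averaging] (9) p. 18, (27) p. 22, (42) p. 23, p. 28).
PLACEMENT: `Summits/QuantumFields/BalabanUV/`; imports the accepted file 1 only.
-/

set_option autoImplicit false

open scoped BigOperators Matrix.Norms.L2Operator
open Finset

namespace Summit.QuantumFields.BalabanUV.T4Continuum.NE3CovariantLineAdjoint

open Literature.MathematicalPhysics.QuantumFieldTheory.Balaban1983to89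
open B7Prop1Explicit B7Prop2Explicit
open T4AveragingDeficitWall (IsUnitaryCfg Ad)
open T4AveragingDeficitWallBoundary (periodBox IsPeriodicCfg)
open AveragingDeficitNearIdentity (Ad_one)
open MinimalActionWitness (flatCfg)
open NE3CovariantCalculus (hsR)

noncomputable section

variable {d : ℕ} {n : Type*} [Fintype n] [DecidableEq n]

/-! ## The covariant transport family of record and the corner-read comb line sum -/

/-- THE COVARIANT COMB FRAME FAMILY: `combFrame W M z κ v i := (combTransport W M z κ v (i+1))⁻¹` — the inverse holonomy of `W`
from the corner `M•z` along the `κ`-last comb word to the END `M•z + v + (i+1)•e_κ` of the copy's bond (so `Ad (combFrame …)⁻¹`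
transports the right-trivialised copy `η (M•z+v+i•e_κ) κ` TO the corner, as the tree's `dhol` does). [folklore] -/
def combFrame (W : Site d → Fin d → (Matrix n n ℂ)ˣ) (M : ℕ) (z : Site d) (κ : Fin d) (v : Site d) (i : ℕ) : (Matrix n n ℂ)ˣ :=
  (combTransport W M z κ v (i + 1))⁻¹

/-- The comb frames of `U(N)` data are unitary. [folklore] -/
theorem combFrame_mem {W : Site d → Fin d → (Matrix n n ℂ)ˣ} (hW : IsUnitaryCfg W) (M : ℕ) (z : Site d) (κ : Fin d) (v : Site d) (i : ℕ) :
    combFrame W M z κ v i ∈ unitaryUnits (Matrix n n ℂ) :=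
  (unitaryUnits (Matrix n n ℂ)).inv_mem (combTransport_mem hW M z κ v (i + 1))

/-- The comb frames of an `(M·N)`-periodic configuration are `N`-periodic in the corner. [folklore] -/
theorem combFrame_add_period {W : Site d → Fin d → (Matrix n n ℂ)ˣ} {M N : ℕ} (hW : IsPeriodicCfg W ((M * N : ℕ) : ℤ))
    (z : Site d) (τ κ : Fin d) (v : Site d) (i : ℕ) :
    combFrame W M (z + (N : ℤ) • e τ) κ v i = combFrame W M z κ v i := by
  unfold combFrame
  rw [combTransport_add_period hW]

/-- `Ad (combFrame …)⁻¹ = Ad (combTransport … (i+1))` — the transport TO the corner. [folklore] -/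
theorem Ad_combFrame_inv (W : Site d → Fin d → (Matrix n n ℂ)ˣ) (M : ℕ) (z : Site d) (κ : Fin d) (v : Site d) (i : ℕ)
    (X : Matrix n n ℂ) : Ad (combFrame W M z κ v i)⁻¹ X = Ad (combTransport W M z κ v (i + 1)) X := by
  rw [combFrame, inv_inv]

/-- **ONE MORE BOND**: `combFrame W M z κ v (i+1) = (W (M•z + v + (i+1)•e_κ) κ)⁻¹ * combFrame W M z κ v i` (from file 1's
`combTransport_succ`): the transport of a corner value to the next copy's frame is the previous one followed by `Ad (W b)⁻¹` across
the copy's bond — the covariant `κ`-step of the line accumulation (K4-b). [folklore] -/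
theorem combFrame_succ (W : Site d → Fin d → (Matrix n n ℂ)ˣ) (M : ℕ) (z : Site d) (κ : Fin d) (v : Site d) (i : ℕ) :
    combFrame W M z κ v (i + 1) = (W ((M : ℤ) • z + v + ((i + 1 : ℕ) : ℤ) • e κ) κ)⁻¹ * combFrame W M z κ v i := by
  unfold combFrame
  rw [combTransport_succ, mul_inv_rev]

/-- **THE CORNER-READ SINGLE-SCALE COMB LINE SUM** (the instance of record for K4-0∕K4-b∕K4-c):
`TWc L k W η := TWg (L^k) (combFrame W (L^k)) η`. [folklore] -/
def TWc (L k : ℕ) (W : Site d → Fin d → (Matrix n n ℂ)ˣ) (η : Site d → Fin d → Matrix n n ℂ) (z : Site d) (κ : Fin d) : Matrix n n ℂ :=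
  TWg (L ^ k) (combFrame W (L ^ k)) η z κ

/-- `TWc` written out: every copy is transported TO the corner by the holonomy of the comb word up to and including its own bond,
`TWc L k W η z κ = Σ_{v∈[0,M)^d} Σ_{i<M} Ad (combTransport W M z κ v (i+1)) (η (M•z + v + i•e_κ) κ)`, `M = L^k`. [folklore] -/
theorem TWc_eq (L k : ℕ) (W : Site d → Fin d → (Matrix n n ℂ)ˣ) (η : Site d → Fin d → Matrix n n ℂ) (z : Site d) (κ : Fin d) :
    TWc L k W η z κ = ∑ v ∈ periodBox (d := d) (L ^ k), ∑ i ∈ range (L ^ k),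
      Ad (combTransport W (L ^ k) z κ v (i + 1)) (η (((L ^ k : ℕ) : ℤ) • z + v + (i : ℤ) • e κ) κ) := by
  unfold TWc TWg
  simp only [Ad_combFrame_inv]

/-- **THE TORUS ADJOINT IDENTITY FOR `TWc`** (any unitary `(L^k·N)`-periodic `W`, `L, N ≥ 1`; `N`-periodic `ω`, `(L^k·N)`-periodic `η`):
`Σ_{z∈periodBox N} Σ_κ hsR (ω z κ) (TWc L k W η z κ) = Σ_{x∈periodBox (L^k·N)} Σ_κ hsR (WadWg (L^k) (combFrame W (L^k)) ω x κ) (η x κ)`,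
where `WadWg … (combFrame …)` transports each coarse value to its copy's frame by `Ad ((combTransport … (i+1))⁻¹)`. [folklore] -/
theorem sum_hsR_TWc_eq {L k N : ℕ} (hL : 1 ≤ L) (hN : 1 ≤ N) {W : Site d → Fin d → (Matrix n n ℂ)ˣ} (hW : IsUnitaryCfg W)
    (hWP : IsPeriodicCfg W ((L ^ k * N : ℕ) : ℤ)) (ω η : Site d → Fin d → Matrix n n ℂ)
    (hω : ∀ (z : Site d) (τ μ : Fin d), ω (z + (N : ℤ) • e τ) μ = ω z μ)
    (hη : ∀ (x : Site d) (τ μ : Fin d), η (x + ((L ^ k * N : ℕ) : ℤ) • e τ) μ = η x μ) :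
    ∑ z ∈ periodBox (d := d) N, ∑ κ : Fin d, hsR (ω z κ) (TWc L k W η z κ)
      = ∑ x ∈ periodBox (d := d) (L ^ k * N), ∑ κ : Fin d, hsR (WadWg (L ^ k) (combFrame W (L ^ k)) ω x κ) (η x κ) :=
  sum_hsR_TWg_eq_sum_hsR_WadWg (Nat.one_le_pow _ _ hL) hN (combFrame W (L ^ k)) (fun z κ v i => combFrame_mem hW _ z κ v i)
    (fun z τ κ v i => combFrame_add_period hWP z τ κ v i) ω η hω hη

/-- At the flat configuration the comb frames are trivial … [folklore] -/
theorem combFrame_flatCfg (M : ℕ) (z : Site d) (κ : Fin d) (v : Site d) (i : ℕ) :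
    combFrame (flatCfg (d := d) (n := n)) M z κ v i = 1 := by
  unfold combFrame combTransport
  have : ∀ (w : List (Letter d)) (x : Site d), hol (flatCfg (d := d) (n := n)) x w = 1 := by
    intro w
    induction w with
    | nil => intro x; rfl
    | cons l w ih =>
        intro x
        rw [hol_cons, ih]
        unfold stepHol MinimalActionWitness.flatCfg
        split_ifs <;> simp
  rw [this, inv_one]

/-- … so `TWc` at `W = 1` is the flat unnormalised line sum of (69S)∕(71S). [folklore] -/
theorem TWc_flatCfg (L k : ℕ) (η : Site d → Fin d → Matrix n n ℂ) (z : Site d) (κ : Fin d) :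
    TWc L k (flatCfg (d := d) (n := n)) η z κ
      = ∑ v ∈ periodBox (d := d) (L ^ k), ∑ i ∈ range (L ^ k), η (((L ^ k : ℕ) : ℤ) • z + v + (i : ℤ) • e κ) κ := by
  unfold TWc TWg
  simp only [combFrame_flatCfg, inv_one, Ad_one]

end

end Summit.QuantumFields.BalabanUV.T4Continuum.NE3CovariantLineAdjoint
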